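import Summits.ResolutionOfSingularities.ResolutionOfSingularities.Theorems.EquisingularLiftEquisingularLiftNatNoseStep
import Summits.ResolutionOfSingularities.ResolutionOfSingularities.Theorems.EquisingularLiftEquisingularLiftNatOneStep
import HarnessLib

/-!
# [OURS · L1 W4.5(b) · EL♮] THE NOSE PACKAGE AT LEVEL 0: one `O`-smooth centre of `ℙⁿ_O` out of `(ℙⁿ_O, 𝟙, Y)`, mirrored on the
# blow-up of `ℙⁿ_k` along `C · 𝒪_{ℙⁿ_k}` (brick 2 of res-L1-w45b-lead-2's TARGET (5) «T-NOSE-THEN-POINTS», 2026-08-27T07:04:41Z)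

Crux `EquisingularLiftNat` = stmt-ResolutionOfSingularities-20038 (route EquisingularLift), line `sections`; helper file
`--supports … --as helper` by res-type-051 (TAKING 2026-08-27T07:23:26Z). HONEST FRAMING: OURS (cell res-hironaka, slot W4.5(b));
NOT a statement of any manuscript. AI-written, weaker than expert review. No `sorry`; standard axioms.

`nosePackage₀` — `noseStep` (…NatNoseStep.lean) at the stage `(ℙⁿ_O, 𝟙, Y)` in the item's `q`-spelling, any `n`: `O` a DVR with a
surjection `π : O → k` onto a field, `ι : H → ℙⁿ_k` a closed immersion of an integral scheme, `φ : O[x] → k[x]` graded inducing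
`MvPolynomial.map π`, `g = Proj φ` (the special fibre, `ProjectiveAmbientFibre.isPullback_projMap`), `Y = g(ι(H))`. INPUT: an ideal
sheaf `C` on `ℙⁿ_O` with `V(C) → Spec O` SMOOTH, `Λ = C · 𝒪_{ℙⁿ_k} = C.comap g` with `ι(H) ⊄ V(Λ)` (off-generic) and `V(Λ) ⊆ ι(H)`
(E1) — the interface of R0 `elNatBody_of_oneStep₀` (p505461) —, ANY blow-up `τ : P′ → ℙⁿ_O` along `C` and ANY blow-up
`υ : F₂ → ℙⁿ_k` along `Λ`. EXACTNESS IS AUTOMATIC here: `V(closure (range ι))_red ≅ H ≅ V(closure Y)_red` compatibly with the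
embeddings into `ℙⁿ_O`, and both traces are `C · 𝒪` along the same morphism. OUTPUT = exactly the input tuple of res-type-022's
`pointResolution_from_horizStage` (T-ISO-0-REL, p509452): `Y` closed irreducible inside the special fibre; the stage
`(P′, τ, closure τ⁻¹(Y ∖ V(C)))` is in the HORIZONTAL E1 closure of `(ℙⁿ_O, 𝟙, Y)`; its special fibre is irreducible (p500485); good
reduction at EVERY point of `P′`; `F₂` locally Noetherian; the downstairs strict transform `closure υ⁻¹(range ι ∖ V(Λ))` irreducible
with `V(closure ·)_red ≅ V(closure (closure τ⁻¹(Y ∖ V(C))))_red`; and `P′ → Spec O` SMOOTH when `O` has characteristic `0` and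
algebraically closed residue field.

References: …NatNoseStep.lean (brick 1), …NatOneStep.lean (R0, p505461: the level-0 bookkeeping is transcribed from
`elNatBody_of_oneStep₀`), …NatHorizChain.lean (p500485), …NatPointResolutionRel.lean (p509452); Liu 2002 Thm 8.1.19, Prop. 3.1.9;
Stacks 080E/0805.
-/

set_option linter.dupNamespace false -- mandated namespace `Summit.<Summit>.<Problem>` of this single-conjunct summit
set_option linter.overlappingInstances false -- signatures carry `[IsDomain O] [IsDiscreteValuationRing O]`

noncomputable section

open CategoryTheory CategoryTheory.Limits AlgebraicGeometry TopologicalSpace Topology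
open MvPolynomial
open Literature.AlgebraicGeometry.Resolution
open AlgebraicGeometry.Scheme.IdealSheafData
open Summit.ResolutionOfSingularities.ResolutionOfSingularities.Theses.EquisingularLift.Split
open Summit.ResolutionOfSingularities.ResolutionOfSingularities.Cruxes.EquisingularLift.StrataSplit

attribute [local instance] MvPolynomial.gradedAlgebra

namespace Summit.ResolutionOfSingularities.ResolutionOfSingularities.Cruxes.EquisingularLiftNat.Sections

/-! ## Level 0 in the item's `q`-spelling: the nose out of `(ℙⁿ_O, 𝟙, Y)`, downstairs the blow-up of `ℙⁿ_k` along `C · 𝒪_{ℙⁿ_k}` -/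

/-- **THE NOSE PACKAGE AT LEVEL 0** (module docstring for the reading): for `Y = g(ι(H)) ⊆ ℙⁿ_O`, an `O`-SMOOTH centre `C` of
`ℙⁿ_O` with `ι(H) ⊄ V(Λ) ⊆ ι(H)` (`Λ = C · 𝒪_{ℙⁿ_k}`), a blow-up `τ : P′ → ℙⁿ_O` along `C` and a blow-up `υ : F₂ → ℙⁿ_k` along `Λ`:
`Y` is closed irreducible inside the special fibre; `(P′, τ, closure τ⁻¹(Y ∖ V(C)))` is in the horizontal E1 closure of
`(ℙⁿ_O, 𝟙, Y)` with irreducible special fibre and good reduction at every point of `P′`; `F₂` is locally Noetherian; the downstairs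
strict transform `closure υ⁻¹(range ι ∖ V(Λ))` is irreducible and its reduced structure is isomorphic to that of the upstairs one; and
`P′ → Spec O` is smooth for `O` of characteristic `0` with algebraically closed residue field.
[folklore; Liu 2002 Thm 8.1.19, Prop. 3.1.9; Stacks 080E, 0805] -/
theorem nosePackage₀ (O : Type) [CommRing O] [IsDomain O] [IsDiscreteValuationRing O]
    (k : Type) [Field k] (π : O →+* k) (hπ : Function.Surjective π) (n : ℕ) (H : Scheme.{0})
    (ι : H ⟶ Proj (homogeneousSubmodule (Fin (n + 1)) k)) [IsClosedImmersion ι] [IsIntegral H]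
    (φ : homogeneousSubmodule (Fin (n + 1)) O →+*ᵍ homogeneousSubmodule (Fin (n + 1)) k)
    (hφ' : HomogeneousIdeal.irrelevant (homogeneousSubmodule (Fin (n + 1)) k) ≤
      (HomogeneousIdeal.irrelevant (homogeneousSubmodule (Fin (n + 1)) O)).map φ)
    (hφ : ∀ s, φ s = MvPolynomial.map π s)
    -- the nose: a centre of `ℙⁿ_O` SMOOTH over `O`, and a blow-up along it
    (C : (Proj (homogeneousSubmodule (Fin (n + 1)) O)).IdealSheafData)
    (hCsm : Smooth (C.subschemeι ≫ Proj.toSpecZero (homogeneousSubmodule (Fin (n + 1)) O) ≫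
      Spec.map (CommRingCat.ofHom (algebraMap O (homogeneousSubmodule (Fin (n + 1)) O 0)))))
    (hgen : ¬ (Set.range ι ⊆ ((C.comap (Proj.map φ hφ')).support : Set (Proj (homogeneousSubmodule (Fin (n + 1)) k)))))
    (hsupp : ((C.comap (Proj.map φ hφ')).support : Set (Proj (homogeneousSubmodule (Fin (n + 1)) k))) ⊆ Set.range ι)
    (P' : Scheme.{0}) (τ : P' ⟶ Proj (homogeneousSubmodule (Fin (n + 1)) O)) (hτ : IsBlowup τ C)
    -- downstairs: any blow-up of `ℙⁿ_k` along `Λ = C · 𝒪_{ℙⁿ_k}`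
    (F₂ : Scheme.{0}) (υ : F₂ ⟶ Proj (homogeneousSubmodule (Fin (n + 1)) k)) (hυ : IsBlowup υ (C.comap (Proj.map φ hφ'))) :
    ∀ Y : Set (Proj (homogeneousSubmodule (Fin (n + 1)) O)), Y = Set.range (ι ≫ Proj.map φ hφ') →
      IsClosed Y ∧ IsIrreducible Y ∧
      Y ⊆ (Proj.toSpecZero (homogeneousSubmodule (Fin (n + 1)) O) ≫
        Spec.map (CommRingCat.ofHom (algebraMap O (homogeneousSubmodule (Fin (n + 1)) O 0)))) ⁻¹' {IsLocalRing.closedPoint O} ∧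
      (∀ Q : (∀ X' : Scheme.{0}, (X' ⟶ Proj (homogeneousSubmodule (Fin (n + 1)) O)) → Set X' → Prop),
        Q (Proj (homogeneousSubmodule (Fin (n + 1)) O)) (𝟙 _) Y →
        (∀ (X' X'' : Scheme.{0}) (σ' : X' ⟶ Proj (homogeneousSubmodule (Fin (n + 1)) O)) (Y' : Set X')
          (C : X'.IdealSheafData) (τ : X'' ⟶ X'), Q X' σ' Y' → IsBlowup τ C → Scheme.IsRegular C.subscheme →
          Flat (C.subschemeι ≫ σ' ≫ (Proj.toSpecZero (homogeneousSubmodule (Fin (n + 1)) O) ≫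
            Spec.map (CommRingCat.ofHom (algebraMap O (homogeneousSubmodule (Fin (n + 1)) O 0))))) →
          σ' '' (C.support : Set X') ⊆ {x | ¬ IsGenericPoint x Y} →
          (C.support : Set X') ∩ (σ' ≫ (Proj.toSpecZero (homogeneousSubmodule (Fin (n + 1)) O) ≫
            Spec.map (CommRingCat.ofHom (algebraMap O (homogeneousSubmodule (Fin (n + 1)) O 0))))) ⁻¹'
            {IsLocalRing.closedPoint O} ⊆ Y' →
          Q X'' (τ ≫ σ') (closure (τ ⁻¹' (Y' \ (C.support : Set X'))))) →
        Q P' τ (closure (τ ⁻¹' (Y \ (C.support : Set (Proj (homogeneousSubmodule (Fin (n + 1)) O))))))) ∧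
      IsIrreducible ((τ ≫ (Proj.toSpecZero (homogeneousSubmodule (Fin (n + 1)) O) ≫
        Spec.map (CommRingCat.ofHom (algebraMap O (homogeneousSubmodule (Fin (n + 1)) O 0))))) ⁻¹'
        {IsLocalRing.closedPoint O}) ∧
      (∀ w : P', GoodAt (τ ≫ (Proj.toSpecZero (homogeneousSubmodule (Fin (n + 1)) O) ≫
        Spec.map (CommRingCat.ofHom (algebraMap O (homogeneousSubmodule (Fin (n + 1)) O 0))))) w) ∧
      IsLocallyNoetherian F₂ ∧
      IsIrreducible (closure (υ ⁻¹' (Set.range ι \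
        ((C.comap (Proj.map φ hφ')).support : Set (Proj (homogeneousSubmodule (Fin (n + 1)) k)))))) ∧
      Nonempty ((vanishingIdeal (⟨closure (closure (υ ⁻¹' (Set.range ι \
          ((C.comap (Proj.map φ hφ')).support : Set (Proj (homogeneousSubmodule (Fin (n + 1)) k)))))), isClosed_closure⟩ :
          Closeds F₂)).subscheme ≅
        (vanishingIdeal (⟨closure (closure (τ ⁻¹' (Y \ (C.support : Set (Proj (homogeneousSubmodule (Fin (n + 1)) O)))))),
          isClosed_closure⟩ : Closeds P')).subscheme) ∧
      (∀ [CharZero O] [IsAlgClosed (IsLocalRing.ResidueField O)],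
        Smooth (τ ≫ (Proj.toSpecZero (homogeneousSubmodule (Fin (n + 1)) O) ≫
          Spec.map (CommRingCat.ofHom (algebraMap O (homogeneousSubmodule (Fin (n + 1)) O 0)))))) := by
  classical
  set q : (Proj (homogeneousSubmodule (Fin (n + 1)) O)) ⟶ Spec (.of O) := Proj.toSpecZero (homogeneousSubmodule (Fin (n + 1)) O) ≫
    Spec.map (CommRingCat.ofHom (algebraMap O (homogeneousSubmodule (Fin (n + 1)) O 0))) with hqdef
  set g : Proj (homogeneousSubmodule (Fin (n + 1)) k) ⟶ (Proj (homogeneousSubmodule (Fin (n + 1)) O)) := Proj.map φ hφ' with hgdef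
  set Λ : (Proj (homogeneousSubmodule (Fin (n + 1)) k)).IdealSheafData := C.comap g with hΛdef
  intro Y hY
  -- the special fibre is the range of the closed immersion `g`
  have hP := ProjectiveAmbientFibre.isPullback_projMap π φ hφ hπ hφ'
  haveI : IsClosedImmersion (Spec.map (CommRingCat.ofHom π)) := IsClosedImmersion.spec_of_surjective _ hπ
  haveI : IsClosedImmersion g := MorphismProperty.IsStableUnderBaseChange.of_isPullback hP.flip inferInstance
  have hpt : ∀ x : Spec (.of k), Spec.map (CommRingCat.ofHom π) x = IsLocalRing.closedPoint O := by
    intro x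
    rw [Spec.map_apply]
    apply PrimeSpectrum.ext
    rw [PrimeSpectrum.comap_asIdeal, CommRingCat.hom_ofHom, Ideal.eq_bot_of_prime x.asIdeal, ← RingHom.ker_eq_comap_bot]
    exact IsLocalRing.eq_maximalIdeal (RingHom.ker_isMaximal_of_surjective π hπ)
  have hgq : ∀ x, q (g x) = IsLocalRing.closedPoint O := fun x ↦
    (Scheme.Hom.comp_apply g q x).symm.trans
      ((congrArg (fun h : Proj (homogeneousSubmodule (Fin (n + 1)) k) ⟶ Spec (.of O) ↦ h x) hP.w).trans
        ((Scheme.Hom.comp_apply _ _ x).trans (hpt _)))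
  have hrange : Set.range g = q ⁻¹' {IsLocalRing.closedPoint O} := by
    refine Set.ext fun y ↦ ⟨?_, fun hy ↦ ?_⟩
    · rintro ⟨x, rfl⟩
      exact hgq x
    · have hy' : q y = IsLocalRing.closedPoint O := hy
      obtain ⟨x, hx, -⟩ := Scheme.exists_preimage_of_isPullback hP y default (hy'.trans (hpt default).symm)
      exact ⟨x, hx⟩
  -- the closed immersion `f = ι ≫ g` and its range `Y`
  let f : H ⟶ (Proj (homogeneousSubmodule (Fin (n + 1)) O)) := ι ≫ g
  have hYf : Y = Set.range f := hY
  have hYcl : IsClosed Y := by rw [hYf]; exact f.isClosedEmbedding.isClosed_range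
  have hYs : Y ⊆ q ⁻¹' {IsLocalRing.closedPoint O} := by
    rw [hYf]
    rintro _ ⟨x, rfl⟩
    change q ((ι ≫ g) x) = _
    rw [Scheme.Hom.comp_apply]
    exact hgq _
  have hgenY : IsGenericPoint (f (genericPoint H)) Y := by
    have h := (genericPoint_spec H).image f.continuous
    rwa [Set.image_univ, f.isClosedEmbedding.isClosed_range.closure_eq, ← hYf] at h
  have hYirr : IsIrreducible Y := by
    have h := (isIrreducible_singleton (x := f (genericPoint H))).closure
    rwa [hgenY] at h
  have hgenι : IsGenericPoint (ι (genericPoint H)) (Set.range ι) := by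
    have h := (genericPoint_spec H).image ι.continuous
    rwa [Set.image_univ, ι.isClosedEmbedding.isClosed_range.closure_eq] at h
  have hιirr : IsIrreducible (Set.range ι) := by
    have h := (isIrreducible_singleton (x := ι (genericPoint H))).closure
    rwa [hgenι] at h
  -- `V(closure Y)_red ≅ H ≅ V(closure (range ι))_red`, compatibly with the embeddings
  let T : Closeds (Proj (homogeneousSubmodule (Fin (n + 1)) O)) := ⟨closure Y, isClosed_closure⟩
  have hYker : vanishingIdeal T = f.ker := by
    rw [← Scheme.IdealSheafData.map_bot, ← Scheme.nilradical_eq_bot, ← Scheme.IdealSheafData.vanishingIdeal_top,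
      Scheme.IdealSheafData.map_vanishingIdeal]
    congr 1
    ext1
    change closure Y = closure (f '' Set.univ)
    rw [Set.image_univ, hYf]
  have hker : (vanishingIdeal T).subschemeι.ker = f.ker := by
    rw [Scheme.IdealSheafData.ker_subschemeι, hYker]
  let eU : H ⟶ (vanishingIdeal T).subscheme := IsClosedImmersion.lift _ f hker.le
  have heU : eU ≫ (vanishingIdeal T).subschemeι = f := IsClosedImmersion.lift_fac _ f hker.le
  haveI : IsIso eU := IsClosedImmersion.isIso_lift _ f hker
  let TD : Closeds (Proj (homogeneousSubmodule (Fin (n + 1)) k)) := ⟨closure (Set.range ι), isClosed_closure⟩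
  have hDker : vanishingIdeal TD = ι.ker := by
    rw [← Scheme.IdealSheafData.map_bot, ← Scheme.nilradical_eq_bot, ← Scheme.IdealSheafData.vanishingIdeal_top,
      Scheme.IdealSheafData.map_vanishingIdeal]
    congr 1
    ext1
    change closure (Set.range ι) = closure (ι '' Set.univ)
    rw [Set.image_univ]
  have hkerD : (vanishingIdeal TD).subschemeι.ker = ι.ker := by
    rw [Scheme.IdealSheafData.ker_subschemeι, hDker]
  let eD : H ⟶ (vanishingIdeal TD).subscheme := IsClosedImmersion.lift _ ι hkerD.le
  have heD : eD ≫ (vanishingIdeal TD).subschemeι = ι := IsClosedImmersion.lift_fac _ ι hkerD.le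
  haveI : IsIso eD := IsClosedImmersion.isIso_lift _ ι hkerD
  let e : (vanishingIdeal TD).subscheme ≅ (vanishingIdeal T).subscheme := (asIso eD).symm ≪≫ asIso eU
  have hsq : (vanishingIdeal TD).subschemeι ≫ g = e.hom ≫ (vanishingIdeal T).subschemeι := by
    have h1 : e.hom = inv eD ≫ eU := rfl
    rw [h1, Category.assoc, heU, ← cancel_epi eD, IsIso.hom_inv_id_assoc, ← Category.assoc, heD]
  -- EXACTNESS at level 0 is automatic: both traces are `C · 𝒪` along the same map to `ℙⁿ_O`
  have hexact : Λ.comap (vanishingIdeal TD).subschemeι = (C.comap (vanishingIdeal T).subschemeι).comap e.hom := by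
    rw [hΛdef, ← Scheme.IdealSheafData.comap_comp, ← Scheme.IdealSheafData.comap_comp, hsq]
  -- preimages along `g`
  have hpreC : g ⁻¹' (C.support : Set (Proj (homogeneousSubmodule (Fin (n + 1)) O))) =
      (Λ.support : Set (Proj (homogeneousSubmodule (Fin (n + 1)) k))) := by
    have h := Scheme.IdealSheafData.support_comap C g
    rw [h]
    rfl
  -- the step hypotheses at level 0
  obtain ⟨hsm, hpr⟩ := stub_projectiveAmbientSmoothProper O n
  have hint := isIntegral_specialFibre_projectiveSpace O n
  have hsm' : Smooth (𝟙 (Proj (homogeneousSubmodule (Fin (n + 1)) O)) ≫ q) := by rw [Category.id_comp]; exact hsm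
  have hCsm' : Smooth (C.subschemeι ≫ 𝟙 (Proj (homogeneousSubmodule (Fin (n + 1)) O)) ≫ q) := by
    rw [Category.id_comp]; exact hCsm
  have himg : (𝟙 (Proj (homogeneousSubmodule (Fin (n + 1)) O)) : (Proj (homogeneousSubmodule (Fin (n + 1)) O)) ⟶
      (Proj (homogeneousSubmodule (Fin (n + 1)) O))) '' (C.support : Set (Proj (homogeneousSubmodule (Fin (n + 1)) O))) ⊆
      {x : (Proj (homogeneousSubmodule (Fin (n + 1)) O)) | ¬ IsGenericPoint x Y} := by
    rintro _ ⟨x, hx, rfl⟩ hgx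
    change IsGenericPoint x Y at hgx
    have hxe : x = f (genericPoint H) := hgx.eq hgenY
    have hmem : ι (genericPoint H) ∈ g ⁻¹' (C.support : Set (Proj (homogeneousSubmodule (Fin (n + 1)) O))) := by
      change g (ι (genericPoint H)) ∈ (C.support : Set (Proj (homogeneousSubmodule (Fin (n + 1)) O)))
      rw [← Scheme.Hom.comp_apply, ← hxe]
      exact hx
    rw [hpreC] at hmem
    apply hgen
    rw [← hgenι]
    exact closure_minimal (Set.singleton_subset_iff.mpr hmem) Λ.support.isClosed
  have hE1 : (C.support : Set (Proj (homogeneousSubmodule (Fin (n + 1)) O))) ∩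
      (𝟙 (Proj (homogeneousSubmodule (Fin (n + 1)) O)) ≫ q) ⁻¹' {IsLocalRing.closedPoint O} ⊆ Y := by
    rintro x ⟨hxC, hxq⟩
    rw [Category.id_comp] at hxq
    have hxg : x ∈ Set.range g := by rw [hrange]; exact hxq
    obtain ⟨x', rfl⟩ := hxg
    have hx' : x' ∈ (Λ.support : Set (Proj (homogeneousSubmodule (Fin (n + 1)) k))) := by rw [← hpreC]; exact hxC
    obtain ⟨h, hh⟩ := hsupp hx'
    rw [hYf]
    exact ⟨h, by rw [← hh]; exact Scheme.Hom.comp_apply _ _ h⟩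
  -- the HORIZONTAL E1 closure of `(ℙⁿ_O, 𝟙, Y)` as an opaque stage predicate
  let Yc : Closeds (Proj (homogeneousSubmodule (Fin (n + 1)) O)) := ⟨Y, hYcl⟩
  obtain ⟨Ch, hCh⟩ : ∃ Ch : ∀ X' : Scheme.{0}, (X' ⟶ Proj (homogeneousSubmodule (Fin (n + 1)) O)) → Set X' → Prop,
      ∀ (X₁ : Scheme.{0}) (σ₁ : X₁ ⟶ Proj (homogeneousSubmodule (Fin (n + 1)) O)) (S₁ : Set X₁), Ch X₁ σ₁ S₁ ↔
      ∀ Q : (∀ X' : Scheme.{0}, (X' ⟶ Proj (homogeneousSubmodule (Fin (n + 1)) O)) → Set X' → Prop),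
        Q (Proj (homogeneousSubmodule (Fin (n + 1)) O)) (𝟙 _) Y →
        (∀ (X' X'' : Scheme.{0}) (σ' : X' ⟶ Proj (homogeneousSubmodule (Fin (n + 1)) O)) (Y' : Set X')
          (C : X'.IdealSheafData) (τ : X'' ⟶ X'), Q X' σ' Y' → IsBlowup τ C → Scheme.IsRegular C.subscheme →
          Flat (C.subschemeι ≫ σ' ≫ q) →
          σ' '' (C.support : Set X') ⊆ {x | ¬ IsGenericPoint x Y} →
          (C.support : Set X') ∩ (σ' ≫ q) ⁻¹' {IsLocalRing.closedPoint O} ⊆ Y' →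
          Q X'' (τ ≫ σ') (closure (τ ⁻¹' (Y' \ (C.support : Set X'))))) →
        Q X₁ σ₁ S₁ := ⟨_, fun _ _ _ => Iff.rfl⟩
  have hChain : ∀ (X' : Scheme.{0}) (σ : X' ⟶ Proj (homogeneousSubmodule (Fin (n + 1)) O)) (S : Set X'),
      Ch X' σ S → Chain (Proj (homogeneousSubmodule (Fin (n + 1)) O)) (Yc : Set (Proj (homogeneousSubmodule (Fin (n + 1)) O))) X' σ S :=
    fun X' σ S h Q h0 hs => (hCh X' σ S).mp h Q h0
      (fun X₁ X₂ σ' Y' C τ hQ hb hr _ hg' _ => hs X₁ X₂ σ' Y' C τ hQ hb hr hg')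
  have hStep : ∀ (X' X'' : Scheme.{0}) (σ' : X' ⟶ Proj (homogeneousSubmodule (Fin (n + 1)) O)) (S' : Set X')
      (C : X'.IdealSheafData) (τ : X'' ⟶ X'),
      Ch X' σ' S' → IsBlowup τ C → Scheme.IsRegular C.subscheme → Flat (C.subschemeι ≫ σ' ≫ q) →
      σ' '' (C.support : Set X') ⊆ {x | ¬ IsGenericPoint x (Yc : Set (Proj (homogeneousSubmodule (Fin (n + 1)) O)))} →
      (C.support : Set X') ∩ (σ' ≫ q) ⁻¹' {IsLocalRing.closedPoint O} ⊆ S' →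
      Ch X'' (τ ≫ σ') (closure (τ ⁻¹' (S' \ (C.support : Set X')))) :=
    fun X' X'' σ' S' C τ h hb hr hfl hg' hE => (hCh _ _ _).mpr fun Q h0 hs =>
      hs X' X'' σ' S' C τ ((hCh X' σ' S').mp h Q h0 hs) hb hr hfl hg' hE
  have hChIrr : ∀ (X' : Scheme.{0}) (σ : X' ⟶ Proj (homogeneousSubmodule (Fin (n + 1)) O)) (S : Set X'),
      Ch X' σ S → IsIrreducible ((σ ≫ q) ⁻¹' {IsLocalRing.closedPoint O}) := fun X' σ S h =>
    (natChain_and_isIrreducible_of_horizChainE1 O (Proj (homogeneousSubmodule (Fin (n + 1)) O)) X' q Y σ S hsm hpr hint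
      hYirr hYcl hYs ((hCh X' σ S).mp h)).2
  have hCh₀ : Ch (Proj (homogeneousSubmodule (Fin (n + 1)) O)) (𝟙 _) Y := (hCh _ _ _).mpr fun Q h0 _ => h0
  -- `ℙⁿ_k` is locally Noetherian
  haveI : IsLocallyNoetherian (Proj (homogeneousSubmodule (Fin (n + 1)) O)) := by
    haveI := hsm
    exact LocallyOfFiniteType.isLocallyNoetherian q
  haveI : IsLocallyNoetherian (Proj (homogeneousSubmodule (Fin (n + 1)) k)) := LocallyOfFiniteType.isLocallyNoetherian g
  -- THE NOSE STEP at the stage `(ℙⁿ_O, 𝟙, Y)`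
  obtain ⟨hCh', hirr', hgood', hF₂, -, hirrD, ⟨e₂⟩, hsmP'⟩ := noseStep O (Proj (homogeneousSubmodule (Fin (n + 1)) O)) q Yc Ch hChain
    hStep hChIrr hsm hpr hYs hYirr (Proj (homogeneousSubmodule (Fin (n + 1)) O)) (𝟙 _) Y hCh₀ hsm' C hCsm' himg hE1 P' τ hτ
    (Proj (homogeneousSubmodule (Fin (n + 1)) k)) F₂ (Set.range ι) ι.isClosedEmbedding.isClosed_range hιirr Λ υ hυ e hexact
  refine ⟨hYcl, hYirr, hYs, ?_, ?_, ?_, hF₂, hirrD, ⟨e₂⟩, ?_⟩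
  · have h := (hCh _ _ _).mp hCh'
    simpa only [Category.comp_id] using h
  · simpa only [Category.comp_id] using hirr'
  · simpa only [Category.comp_id] using hgood'
  · intro _ _
    simpa only [Category.comp_id] using hsmP'

end Summit.ResolutionOfSingularities.ResolutionOfSingularities.Cruxes.EquisingularLiftNat.Sections

end
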